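import Mathlib.Logic.Relation
import Mathlib.Data.Setoid.Basic
import Mathlib.Logic.Function.Basic
import HarnessLib

/-!
# The glued blob graph of a neck-region structure: every single switch is visible (stub S10', brick B8 = D1 core)

Crux `Summit.CriticalPhenomena.CardyFormulaZ2.Theses.CardyMagicRigidity.NestingRigidity`
(stmt-CriticalPhenomena-4835), line `pinch-resampling` v4, registered stub `stub_neckTomographyV4`
(`FiveArmUpperT → FiveArmUpperZ2 → NoNeckRigidity → NeckHookupCoarseT → NeckHookupCoarseZ2 → LoopLimitZ2Blind →
LoopLimitZ2EqT`).  Part (i) of its mechanism (audit `S4-audit.md` §2, typing note `S10p-typing.md` §1) reads a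
percolation configuration near the macroscopic loops as: NECK REGIONS `j : ι` (disjoint `r`-boxes crossed by exactly
two open and two closed strands), the open clusters ("P-blobs", `β`) and closed clusters ("D-blobs", `γ`) of the
configuration OFF the region interiors, the incidence data — region `j` is entered by the two open strands from the
P-blobs `pEnds j = (P₁ j, P₂ j)` and by the two closed strands from the D-blobs `dEnds j = (D₁ j, D₂ j)`, the four
strands ALTERNATING around `∂R_j` — and the STATE `b j` of each region (`true` = P-hooked: the two open strands are
joined by an open path inside the region; `false` = D-hooked: the two closed strands are; under the four-strand
condition exactly one holds, by planar duality inside the disc).  The GLUED structure `glue(ζ, b)` joins `P₁ j ~ P₂ j`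
for every P-hooked `j` and `D₁ j ~ D₂ j` for every D-hooked `j`; its two partitions (`pGlue`, `dGlue`: the
equivalence closures, as `Setoid`s) are the traces on the blobs of the open, resp. closed, clusters of the FULL configuration, and
they are what the blind data see (audit (i.2)/(i.4)).

This file is the lattice-free, sorry-free CORE of the structure theorem D1, over an abstract incidence structure
`(pEnds, dEnds)`:

* `pGlue`, `dGlue` (`Setoid`-valued: the two glued PARTITIONS), their monotonicity in the state vector and the effect
  of `Function.update`;
* the PLANARITY AXIOM at `(b, j)` (a displayed hypothesis, no predicate is introduced): "the P-ends of `j` glued WITHOUT `j` and the D-ends of `j`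
  glued WITHOUT `j` do not both hold" — on a lattice this is the Jordan curve theorem: a glued P-route from `P₁ j` to
  `P₂ j` avoiding `R_j`, closed up through `R_j`, is a Jordan curve meeting `R̄_j` in one cross-cut between the two
  P-germs; the D-germs alternate with the P-germs on `∂R_j`, so they lie on opposite sides (a short transversal inside
  `R_j` crosses the curve once); a glued D-route from `D₁ j` to `D₂ j` avoiding `R_j` runs through closed sites and
  D-hooked regions, the curve through open sites and P-hooked regions `≠ j` — disjoint, contradiction.  (Discrete
  versions in the tree: `walkWinding_eq_of_walk` / `lrCrossing_xor_dualTBCrossing_holds` on `ℤ²`, `PlanarDuality.lean`;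
  the `𝕋` hex lemma `SiteCrossingDuality.lean`.)  Stated here as a hypothesis, it is the ONLY planar input;
* **`pGlue_update_ne_or_dGlue_update_ne`** (registered anchor, audit (i.2)): under planarity at `(b, j)`, switching
  the state of the single region `j` changes the glued P-partition or the glued D-partition — so every single
  re-pairing is blind-visible (modulo `ε`-shadows), and residual ambiguity is a multi-region phenomenon;
* ADMISSIBLE states (equal glued partitions = same blind data; two displayed hypotheses), the MANDATORY regions
  (`eq_false_of_not_pGlue`, `eq_true_of_not_dGlue`: a region whose P-ends are not glued is D-hooked in every admissible state, and dually —
  these are the unambiguous regions of the identification step), and the MOVED-REGION lemma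
  `exists_moved_of_glue_eq` / `exists_moved_of_glue_eq'`: two admissible states never differ by switches in one
  direction only — if `j` is P-hooked in `b` and D-hooked in the admissible `b'`, some other region is D-hooked in `b`
  and P-hooked in `b'` (the open region MOVES along a cycle of the glued structure, it does not disappear; audit (i.3):
  "ambiguity = which region of a cycle is the open one").

Pure logic over `Relation.EqvGen` / `Setoid`; no percolation object is mentioned and no `Prop`-valued definition is
introduced (the planarity axiom and admissibility are displayed hypotheses).
-/

namespace Summit.CriticalPhenomena.CardyFormulaZ2.Cruxes.NestingRigidity.PinchResampling

open Relation Function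

section BlobGraph

variable {ι β γ : Type*}

/-- **The glued P-partition** (an equivalence relation on the P-blobs `β`): `x, y` are glued in the state vector
`b` when they are joined by a chain of P-hooked regions (`b i = true`) through their P-ends — the equivalence closure
(`Relation.EqvGen.setoid`) of "some P-hooked region has P-ends `(x, y)`".  On a lattice: `x` and `y` lie in the same
open cluster of the full configuration. -/
def pGlue (pEnds : ι → β × β) (b : ι → Bool) : Setoid β :=
  EqvGen.setoid fun x y ↦ ∃ i, b i = true ∧ pEnds i = (x, y)

/-- **The glued D-partition** (an equivalence relation on the D-blobs `γ`): `x, y` are glued in the state vector `b`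
when they are joined by a chain of D-hooked regions (`b i = false`) through their D-ends. -/
def dGlue (dEnds : ι → γ × γ) (b : ι → Bool) : Setoid γ :=
  EqvGen.setoid fun x y ↦ ∃ i, b i = false ∧ dEnds i = (x, y)

/-- Unfolding `pGlue`: the relation is the equivalence closure. -/
theorem pGlue_apply_iff (pEnds : ι → β × β) (b : ι → Bool) (x y : β) :
    pGlue pEnds b x y ↔ EqvGen (fun x y ↦ ∃ i, b i = true ∧ pEnds i = (x, y)) x y :=
  Iff.rfl

/-- Unfolding `dGlue`: the relation is the equivalence closure. -/
theorem dGlue_apply_iff (dEnds : ι → γ × γ) (b : ι → Bool) (x y : γ) :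
    dGlue dEnds b x y ↔ EqvGen (fun x y ↦ ∃ i, b i = false ∧ dEnds i = (x, y)) x y :=
  Iff.rfl

/-- The P-ends of a P-hooked region are glued. -/
theorem pGlue_ends (pEnds : ι → β × β) {b : ι → Bool} {j : ι} (hj : b j = true) :
    pGlue pEnds b (pEnds j).1 (pEnds j).2 :=
  EqvGen.rel _ _ ⟨j, hj, rfl⟩

/-- The D-ends of a D-hooked region are glued. -/
theorem dGlue_ends (dEnds : ι → γ × γ) {b : ι → Bool} {j : ι} (hj : b j = false) :
    dGlue dEnds b (dEnds j).1 (dEnds j).2 :=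
  EqvGen.rel _ _ ⟨j, hj, rfl⟩

/-- **Monotonicity**: more P-hooked regions glue more P-blobs. -/
theorem pGlue_mono (pEnds : ι → β × β) {b b' : ι → Bool} (h : ∀ i, b i = true → b' i = true) :
    pGlue pEnds b ≤ pGlue pEnds b' :=
  fun x y hxy ↦ EqvGen.mono (fun _ _ ⟨i, hi, he⟩ ↦ ⟨i, h i hi, he⟩) x y hxy

/-- **Monotonicity**: more D-hooked regions glue more D-blobs. -/
theorem dGlue_mono (dEnds : ι → γ × γ) {b b' : ι → Bool} (h : ∀ i, b i = false → b' i = false) :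
    dGlue dEnds b ≤ dGlue dEnds b' :=
  fun x y hxy ↦ EqvGen.mono (fun _ _ ⟨i, hi, he⟩ ↦ ⟨i, h i hi, he⟩) x y hxy

variable [DecidableEq ι]

/-- Setting an already P-hooked region to P-hooked changes nothing. -/
theorem update_true_of_eq_true {b : ι → Bool} {j : ι} (hj : b j = true) : update b j true = b := by
  rw [← hj, update_eq_self]

/-- Setting an already D-hooked region to D-hooked changes nothing. -/
theorem update_false_of_eq_false {b : ι → Bool} {j : ι} (hj : b j = false) : update b j false = b := by
  rw [← hj, update_eq_self]

/-! **The planarity axiom at region `j` in state `b`** (written out as the hypothesis `hpl` of every statement below,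
no predicate is introduced): it is NOT the case that both the P-ends of `j` are glued without using `j` (state vector
`update b j false`) and the D-ends of `j` are glued without using `j` (state vector `update b j true`):
`¬ (pGlue pEnds (update b j false) (pEnds j).1 (pEnds j).2 ∧ dGlue dEnds (update b j true) (dEnds j).1 (dEnds j).2)`.
On a lattice this is the Jordan curve theorem applied to a glued P-circuit through `R_j` and the alternation of the four
germs on `∂R_j` (module docstring); the P-route and the D-route use disjoint sets of regions (`≠ j`, P-hooked resp.
D-hooked in the SAME `b`) and disjoint colours outside, which is why one state vector `b` appears on both sides.  It
fails for non-planar incidence data (e.g. one region whose P-ends coincide and whose D-ends coincide), so it is a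
genuine hypothesis. -/

/-- **Every single switch is visible (registered anchor; audit (i.2), the deterministic core of D1).**  Under the
planarity axiom at `(b, j)` — not both "P-ends of `j` glued without `j`" and "D-ends of `j` glued without `j`" —
switching the state of the one region `j` (`b ↦ update b j (!b j)`) changes the glued P-partition or the glued
D-partition.  Proof: if `j` was P-hooked, the new state removes the P-edge `j` and adds the D-edge `j`; unchanged
P-partition means the P-ends of `j` stay glued without `j`, unchanged D-partition means the D-ends of `j` were already
glued (without `j`, which was not a D-edge) — both at once contradict planarity; dually if `j` was D-hooked.
Consequence for the transfer: at blind precision `ε ≪ r` a single re-pairing is seen by the blind data (partitions of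
blobs of size `≥ r` are blind-visible modulo `ε`-shadows, good event G2), so blind ambiguity is never a one-region
phenomenon. -/
theorem pGlue_update_ne_or_dGlue_update_ne : ∀ {ι β γ : Type*} [DecidableEq ι] (pEnds : ι → β × β) (dEnds : ι → γ × γ) (b : ι → Bool) (j : ι), ¬ (Summit.CriticalPhenomena.CardyFormulaZ2.Cruxes.NestingRigidity.PinchResampling.pGlue pEnds (Function.update b j false) (pEnds j).1 (pEnds j).2 ∧ Summit.CriticalPhenomena.CardyFormulaZ2.Cruxes.NestingRigidity.PinchResampling.dGlue dEnds (Function.update b j true) (dEnds j).1 (dEnds j).2) → Summit.CriticalPhenomena.CardyFormulaZ2.Cruxes.NestingRigidity.PinchResampling.pGlue pEnds (Function.update b j (!b j)) ≠ Summit.CriticalPhenomena.CardyFormulaZ2.Cruxes.NestingRigidity.PinchResampling.pGlue pEnds b ∨ Summit.CriticalPhenomena.CardyFormulaZ2.Cruxes.NestingRigidity.PinchResampling.dGlue dEnds (Function.update b j (!b j)) ≠ Summit.CriticalPhenomena.CardyFormulaZ2.Cruxes.NestingRigidity.PinchResampling.dGlue dEnds b := by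
  intro ι β γ _ pEnds dEnds b j hpl
  by_contra hcon
  simp only [not_or, not_not] at hcon
  obtain ⟨hP, hD⟩ := hcon
  refine hpl ⟨?_, ?_⟩
  · -- the P-ends of `j` are glued without `j`
    cases hj : b j
    · -- `j` was D-hooked: `update b j false = b`, and in the switched state `j` is P-hooked
      rw [update_false_of_eq_false hj, ← hP, hj]
      exact pGlue_ends pEnds (by simp)
    · -- `j` was P-hooked: the switched state is `update b j false`, with the P-partition of `b`
      have h := pGlue_ends pEnds hj
      rw [← hP, hj] at h
      exact h
  · -- the D-ends of `j` are glued without `j`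
    cases hj : b j
    · -- `j` was D-hooked: the switched state is `update b j true`, with the D-partition of `b`
      have h := dGlue_ends dEnds hj
      rw [← hD, hj] at h
      exact h
    · -- `j` was P-hooked: `update b j true = b`, and in the switched state `j` is D-hooked
      rw [update_true_of_eq_true hj, ← hD, hj]
      exact dGlue_ends dEnds (by simp)

/-- The same, stated as: the pair (glued P-partition, glued D-partition) changes under every single switch. -/
theorem glue_pair_update_ne (pEnds : ι → β × β) (dEnds : ι → γ × γ) (b : ι → Bool) (j : ι)
    (hpl : ¬ (pGlue pEnds (update b j false) (pEnds j).1 (pEnds j).2 ∧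
      dGlue dEnds (update b j true) (dEnds j).1 (dEnds j).2)) :
    (pGlue pEnds (update b j (!b j)), dGlue dEnds (update b j (!b j))) ≠ (pGlue pEnds b, dGlue dEnds b) := by
  intro h
  rcases pGlue_update_ne_or_dGlue_update_ne pEnds dEnds b j hpl with hP | hD
  · exact hP (congrArg Prod.fst h)
  · exact hD (congrArg Prod.snd h)

/-! ### Admissible states: equal glued partitions

A state vector `b'` is ADMISSIBLE relative to `b` when `pGlue pEnds b' = pGlue pEnds b` and `dGlue dEnds b' = dGlue
dEnds b` — in the transfer, the region states compatible with the blind data of the configuration (audit (i.4): blind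
closeness of two good configurations forces equal glued partitions, and conversely).  Written out as two hypotheses. -/

omit [DecidableEq ι] in
/-- **Mandatory D-hooked regions**: a region whose P-ends are NOT glued in `b` is D-hooked in `b` … -/
theorem eq_false_of_not_pGlue (pEnds : ι → β × β) {b : ι → Bool} {j : ι}
    (h : ¬ pGlue pEnds b (pEnds j).1 (pEnds j).2) : b j = false := by
  cases hj : b j
  · rfl
  · exact absurd (pGlue_ends pEnds hj) h

omit [DecidableEq ι] in
/-- … and in every admissible state (an UNAMBIGUOUS region of the identification step). -/
theorem eq_false_of_not_pGlue_of_pGlue_eq (pEnds : ι → β × β) {b b' : ι → Bool} {j : ι}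
    (h : ¬ pGlue pEnds b (pEnds j).1 (pEnds j).2) (hP : pGlue pEnds b' = pGlue pEnds b) : b' j = false :=
  eq_false_of_not_pGlue pEnds (by rw [hP]; exact h)

omit [DecidableEq ι] in
/-- **Mandatory P-hooked regions**: a region whose D-ends are NOT glued in `b` is P-hooked in `b` … -/
theorem eq_true_of_not_dGlue (dEnds : ι → γ × γ) {b : ι → Bool} {j : ι}
    (h : ¬ dGlue dEnds b (dEnds j).1 (dEnds j).2) : b j = true := by
  cases hj : b j
  · exact absurd (dGlue_ends dEnds hj) h
  · rfl

omit [DecidableEq ι] in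
/-- … and in every admissible state. -/
theorem eq_true_of_not_dGlue_of_dGlue_eq (dEnds : ι → γ × γ) {b b' : ι → Bool} {j : ι}
    (h : ¬ dGlue dEnds b (dEnds j).1 (dEnds j).2) (hD : dGlue dEnds b' = dGlue dEnds b) : b' j = true :=
  eq_true_of_not_dGlue dEnds (by rw [hD]; exact h)

omit [DecidableEq ι] in
/-- A region that VARIES among admissible states has both end pairs glued (it lies on a cycle of the glued
P-structure and on a cycle of the glued D-structure: the "free" regions of the audit; all other regions are
unambiguous). -/
theorem pGlue_and_dGlue_of_ne (pEnds : ι → β × β) (dEnds : ι → γ × γ) {b b' : ι → Bool} {j : ι}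
    (hP : pGlue pEnds b' = pGlue pEnds b) (hD : dGlue dEnds b' = dGlue dEnds b) (hne : b' j ≠ b j) :
    pGlue pEnds b (pEnds j).1 (pEnds j).2 ∧ dGlue dEnds b (dEnds j).1 (dEnds j).2 := by
  constructor
  · by_contra h
    exact hne ((eq_false_of_not_pGlue_of_pGlue_eq pEnds h hP).trans (eq_false_of_not_pGlue pEnds h).symm)
  · by_contra h
    exact hne ((eq_true_of_not_dGlue_of_dGlue_eq dEnds h hD).trans (eq_true_of_not_dGlue dEnds h).symm)

/-- **The open region moves, it does not disappear (audit (i.3), ambiguity structure).**  Under planarity at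
`(b, j)`: if `j` is P-hooked in `b` and D-hooked in an admissible `b'`, then some OTHER region is D-hooked in `b` and
P-hooked in `b'`.  (Otherwise the P-hooked regions of `b'` are P-hooked regions of `b` other than `j`, so the P-ends of
`j`, glued in `b'` hence in `b`, are glued without `j`; and the D-ends of `j`, glued in `b'` where `j` is a D-edge,
are glued in `b`, where `j` is not — contradicting planarity.) -/
theorem exists_moved_of_glue_eq (pEnds : ι → β × β) (dEnds : ι → γ × γ) {b b' : ι → Bool} {j : ι}
    (hpl : ¬ (pGlue pEnds (update b j false) (pEnds j).1 (pEnds j).2 ∧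
      dGlue dEnds (update b j true) (dEnds j).1 (dEnds j).2))
    (hP : pGlue pEnds b' = pGlue pEnds b) (hD : dGlue dEnds b' = dGlue dEnds b) (hj : b j = true)
    (hj' : b' j = false) : ∃ k, k ≠ j ∧ b k = false ∧ b' k = true := by
  by_contra hno
  simp only [not_exists, not_and] at hno
  refine hpl ⟨?_, ?_⟩
  · -- P-edges of `b'` are P-edges of `update b j false`
    have hsub : ∀ i, b' i = true → update b j false i = true := by
      intro i hi
      have hij : i ≠ j := fun h ↦ by rw [h, hj'] at hi; exact Bool.false_ne_true hi
      rw [update_of_ne hij]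
      cases hbi : b i
      · exact (hno i hij hbi hi).elim
      · rfl
    refine pGlue_mono pEnds hsub ?_
    rw [hP]
    exact pGlue_ends pEnds hj
  · rw [update_true_of_eq_true hj, ← hD]
    exact dGlue_ends dEnds hj'

/-- **Dual form**: if `j` is D-hooked in `b` and P-hooked in an admissible `b'`, then (under planarity at `(b, j)`)
some other region is P-hooked in `b` and D-hooked in `b'`. -/
theorem exists_moved_of_glue_eq' (pEnds : ι → β × β) (dEnds : ι → γ × γ) {b b' : ι → Bool} {j : ι}
    (hpl : ¬ (pGlue pEnds (update b j false) (pEnds j).1 (pEnds j).2 ∧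
      dGlue dEnds (update b j true) (dEnds j).1 (dEnds j).2))
    (hP : pGlue pEnds b' = pGlue pEnds b) (hD : dGlue dEnds b' = dGlue dEnds b) (hj : b j = false)
    (hj' : b' j = true) : ∃ k, k ≠ j ∧ b k = true ∧ b' k = false := by
  by_contra hno
  simp only [not_exists, not_and] at hno
  refine hpl ⟨?_, ?_⟩
  · rw [update_false_of_eq_false hj, ← hP]
    exact pGlue_ends pEnds hj'
  · -- D-edges of `b'` are D-edges of `update b j true`
    have hsub : ∀ i, b' i = false → update b j true i = false := by
      intro i hi
      have hij : i ≠ j := fun h ↦ by rw [h, hj'] at hi; exact Bool.false_ne_true hi.symm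
      rw [update_of_ne hij]
      cases hbi : b i
      · rfl
      · exact (hno i hij hbi hi).elim
    refine dGlue_mono dEnds hsub ?_
    rw [hD]
    exact dGlue_ends dEnds hj

/-- **Two distinct admissible states of a planar structure differ in both directions**: some region is P-hooked in
`b` and D-hooked in `b'`, and some region is D-hooked in `b` and P-hooked in `b'`.  (So an admissible re-assignment
never just opens or just closes regions; in the cycle picture, exactly the position of the open region along each
ambiguous cycle is free.) -/
theorem exists_true_false_and_exists_false_true_of_glue_eq (pEnds : ι → β × β) (dEnds : ι → γ × γ)
    {b b' : ι → Bool}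
    (hpl : ∀ j, ¬ (pGlue pEnds (update b j false) (pEnds j).1 (pEnds j).2 ∧
      dGlue dEnds (update b j true) (dEnds j).1 (dEnds j).2))
    (hP : pGlue pEnds b' = pGlue pEnds b) (hD : dGlue dEnds b' = dGlue dEnds b) (hne : b' ≠ b) :
    (∃ j, b j = true ∧ b' j = false) ∧ ∃ k, b k = false ∧ b' k = true := by
  obtain ⟨j, hj⟩ := Function.ne_iff.1 hne
  cases hbj : b j
  · have hb'j : b' j = true := by simpa [hbj] using hj
    obtain ⟨k, -, hk, hk'⟩ := exists_moved_of_glue_eq' pEnds dEnds (hpl j) hP hD hbj hb'j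
    exact ⟨⟨k, hk, hk'⟩, ⟨j, hbj, hb'j⟩⟩
  · have hb'j : b' j = false := by simpa [hbj] using hj
    obtain ⟨k, -, hk, hk'⟩ := exists_moved_of_glue_eq pEnds dEnds (hpl j) hP hD hbj hb'j
    exact ⟨⟨j, hbj, hb'j⟩, ⟨k, hk, hk'⟩⟩

end BlobGraph

end Summit.CriticalPhenomena.CardyFormulaZ2.Cruxes.NestingRigidity.PinchResampling
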